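import Summits.HodgeConjecture.HodgeConjecture.Theorems.VHCAbelianSchemesRoadExtJumpLocusLifts
import Summits.Ventures.HSemireg.DerivedDescentBaseChange
import Literature.Algebra.Homology.DerivedFaithfulOfUnitRetraction
import Literature.AlgebraicGeometry.Motives.AbelianVarietyIsogenyPullbackExact
import HarnessLib

/-!
# Road №4 (`VHCAbelianSchemesRoad`), crux stmt-HodgeConjecture-26512 `DiagLocalOfMarkmanPinnedForall` — support line «sigma-descent-along-q»
# on (N-U)'s admissibility field, input (Dq-Inj): **`q^{**}` IS INJECTIVE ON SHIFTED HOMS INTO A BOUNDED VECTOR-BUNDLE COMPLEX**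

research route conditional on HC_CM; not a corollary; Q11.4-sentence-2 already refuted in dim ≥ 3.

Seat core-w5 gen 5 (width copy «width 5» of core-D; director-hodge g17 R17.107: (Dq-Inj) = library item (L1) of the support line
`Cruxes/DiagLocalOfMarkmanPinnedForall/SigmaDescent.lean` 7c4a19848ae2; claim-free, `--supports stmt-HodgeConjecture-26512 --as helper`).
Infrastructure for the support line on (N-U)'s `adm` field; proves NOTHING about (U-Σ), (Dq-σ), (N-U), any registered stub, 26512,
№4, HC_AV, HC_CM or HC; HC_CM HELD, by name only; typed ≠ proved.

THE STATEMENT. For a secant–quotient datum `D` (quotient isogeny `q : P = J × Ĵ ⟶ Y`), complexes `M•`, `L•` of `𝒪_Y`-modules with `L•` a bounded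
complex of vector bundles, and every `k : ℤ`, the action
`q^{**} = Summit.Ventures.HSemireg.mapShiftedHom (Scheme.Modules.pullback q) : Hom_{D(Y)}(Q M•, (Q L•)⟦k⟧) → Hom_{D(P)}(Q q^*M•, (Q q^*L•)⟦k⟧)`
(the body of the line's `pullbackExt D`, ambient `HasDerivedCategory.standard`, `q^*` exact by `IsIsogeny.preservesFiniteLimits_pullback`) is
INJECTIVE — `pullbackExt_injective`; the line's (Dq-Inj) `PullbackExtInjective` asks this with the extra (unused) hypothesis that `M•` is a
bounded vector-bundle complex too, so the bind is one token for the line's owner (Theorems files import no `Cruxes` module).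

THE PROOF (no derived `q_*`, no compatibility of the tree's `shiftedHomLinearEquivPullbackPushforwardOfVectorBundles` with `mapShiftedHom`):
`Literature.Algebra.Homology.shiftedHom_map_mapDerivedCategory_injective` (file `Algebra/Homology/DerivedFaithfulOfUnitRetraction`: `D(L)` of an
exact left adjoint `L ⊣ R` is injective on `Hom_D(Q M, (Q N)⟦k⟧)` as soon as the unit of `N⟦k⟧` is split termwise by a chain map and `L•(N⟦k⟧)`
has a K-injective resolution `ι` with `R• ι` a quasi-isomorphism) fed with

* `exists_unitRetraction_quotientPullback` — (R♮) the unit `η : N ⟶ q_*•q^*•N` of a complex of vector bundles on `Y` is split termwise by the CHAIN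
  MAP `n⁻¹ · ρ•`, `ρ` the trace retraction of The Stacks Project, Tag 0BVH (`Modules/PullbackPushforwardTraceRetraction`: `η ≫ ρ = n • 𝟙`, natural),
  `n = deg q ≠ 0` from the degree framing `exists_constRank_frames_pushforward_unit_q` (p677847) — the (R) brick `exists_retract_pushforward_quotientPullback`
  re-run keeping `i = η•`, which its statement discards;
* `exists_kInjectiveResolution_quotientPullback` — an injective resolution `ι : q^*•N ⟶ I•` of a bounded-below complex of vector bundles on `J × Ĵ`
  (Mathlib `CochainComplex.Plus.modelCategoryQuillen.exists_quasiIso_injective`, enough injectives in `Mod 𝒪`) is K-injective and `q_*•ι` is a quasi-isomorphism (Leray for the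
  affine `q`, `Modules/PushforwardInjectiveResolution.quasiIso_pushforward_map_of_injective_of_isFiniteLocallyFree`);

both at `N := L•⟦k⟧`. Why char `0` matters: without the trace splitting `q^*` kills Artin–Schreier classes in `Ext¹(𝒪, 𝒪) = H¹(𝒪)` in characteristic `p`.

References: [cite: Markman2025SecantWeil, §9.3 Lemma 9.3.9 («the arrows labeled `q^*` are isomorphisms» onto the invariants; only injectivity here)]
[cite: Mukai1978, §3 Prop. 3.12 (p. 249)] [cite: StacksProject, Tag 0BVH, Tag 0DVC and Tag 01XC] [cite: Lipman2009, Prop. 3.2.3]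
[cite: MumfordAV1970, §7 Thm. 4 (p. 72)] [cite: Hartshorne1977, II §5 p. 110 and III Prop. 8.1].
-/

noncomputable section

-- `TopCat.Presheaf`/`Scheme.Modules` are not reducible (as in Mathlib's `AlgebraicGeometry/Modules/Sheaf.lean`).
set_option backward.isDefEq.respectTransparency false

open CategoryTheory CategoryTheory.Category CategoryTheory.Limits AlgebraicGeometry
open DerivedCategory

namespace Summit.HodgeConjecture.HodgeConjecture.Ring2.SemiregularRepresentatives

set_option linter.dupNamespace false -- the cell's namespace repeats the summit name, as in every `Ring2*` file

namespace NowhereDisplaceable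

open Literature.AlgebraicGeometry Literature.AlgebraicGeometry.Motives Literature.AlgebraicGeometry.Motives.AbelianVariety
open Literature.AlgebraicGeometry.KTheory Literature.AlgebraicGeometry.Modules Literature.Algebra.Homology
open Summit.HodgeConjecture.HodgeConjecture.Ring2.SemiregularRepresentatives.MoverTrap

/-! ## §1 (R♮) — the unit `η : N ⟶ q_*•q^*•N` of a complex of vector bundles on `Y` is split termwise by a chain map -/

/-- **(R♮) THE UNIT SPLITS, BY A CHAIN MAP**: for a complex `N•` of finite locally free `𝒪_Y`-modules on the secant quotient `Y` there is a chain
map `r : q_*•q^*•N• ⟶ N•` with `η_{Nⁱ} ≫ rⁱ = 𝟙` for every `i` — `rⁱ = n⁻¹ · ρ_{Nⁱ}` with `ρ` the trace retraction (`η ≫ ρ = n • 𝟙`, natural in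
the module, Stacks 0BVH) and `n = deg q ≠ 0` the constant frame cardinality of `q_*𝒪_{J×Ĵ}` (`exists_constRank_frames_pushforward_unit_q`).
The (R) brick `exists_retract_pushforward_quotientPullback` with its section remembered to be the unit.
[cite: StacksProject, Tag 0BVH] [cite: MumfordAV1970, §7 Thm. 4 (p. 72)] -/
theorem exists_unitRetraction_quotientPullback (D : SecantQuotientDatum) (N : CochainComplex D.Y.X.left.Modules ℤ)
    (hN : ∀ i, IsFiniteLocallyFree (N.X i)) :
    ∃ r : ((Scheme.Modules.pushforward (Hom.toSchemeHom D.q)).mapHomologicalComplex (ComplexShape.up ℤ)).obj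
        (quotientPullbackComplex D N) ⟶ N,
      ∀ i, (Scheme.Modules.pullbackPushforwardAdjunction (Hom.toSchemeHom D.q)).unit.app (N.X i) ≫ r.f i = 𝟙 (N.X i) := by
  haveI : IsFinite (Hom.toSchemeHom D.q) := D.isIsogeny_q.2
  have h := isFiniteLocallyFree_pushforward_unit_q D
  obtain ⟨n, hn0, hn⟩ := exists_constRank_frames_pushforward_unit_q D
  have hal : ∀ X : D.Y.X.left.Modules, IsFiniteLocallyFree X → IsAffineLocalizing X := fun X hX => by
    haveI := hX.isVectorBundle.1
    exact IsAffineLocalizing.of_isQuasicoherent X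
  -- `ρ'_X := n⁻¹ · ρ_X`, natural among vector bundles, with `η_X ≫ ρ'_X = 𝟙`
  let ρ : ∀ X : D.Y.X.left.Modules, IsFiniteLocallyFree X →
      ((Scheme.Modules.pushforward (Hom.toSchemeHom D.q)).obj ((Scheme.Modules.pullback (Hom.toSchemeHom D.q)).obj X) ⟶ X) :=
    fun X hX => ((n : ℂ)⁻¹) • traceRetraction (Hom.toSchemeHom D.q) h X (hal X hX)
  have hnat : ∀ {X X' : D.Y.X.left.Modules} (hX : IsFiniteLocallyFree X) (hX' : IsFiniteLocallyFree X') (φ : X ⟶ X'),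
      (Scheme.Modules.pushforward (Hom.toSchemeHom D.q)).map ((Scheme.Modules.pullback (Hom.toSchemeHom D.q)).map φ) ≫ ρ X' hX' =
        ρ X hX ≫ φ := fun hX hX' φ => by
    change (Scheme.Modules.pushforward (Hom.toSchemeHom D.q)).map ((Scheme.Modules.pullback (Hom.toSchemeHom D.q)).map φ) ≫
        ((n : ℂ)⁻¹ • traceRetraction (Hom.toSchemeHom D.q) h _ _) = ((n : ℂ)⁻¹ • traceRetraction (Hom.toSchemeHom D.q) h _ _) ≫ φ
    rw [Linear.comp_smul, Linear.smul_comp, traceRetraction_naturality]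
  have hsplit : ∀ (X : D.Y.X.left.Modules) (hX : IsFiniteLocallyFree X),
      (Scheme.Modules.pullbackPushforwardAdjunction (Hom.toSchemeHom D.q)).unit.app X ≫ ρ X hX = 𝟙 X := fun X hX => by
    change pullbackUnit (Hom.toSchemeHom D.q) X ≫ ((n : ℂ)⁻¹ • traceRetraction (Hom.toSchemeHom D.q) h X (hal X hX)) = 𝟙 X
    rw [Linear.comp_smul, pullbackUnit_comp_traceRetraction (Hom.toSchemeHom D.q) h X (hal X hX) n hn,
      ← Nat.cast_smul_eq_nsmul ℂ, smul_smul, inv_mul_cancel₀ (Nat.cast_ne_zero.mpr hn0), one_smul]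
  exact ⟨{ f := fun i => ρ (N.X i) (hN i)
           comm' := fun i j _ => (hnat (hN i) (hN j) (N.d i j)).symm }, fun i => hsplit (N.X i) (hN i)⟩

/-! ## §2 A K-injective resolution of `q^*•N` whose direct image is a quasi-isomorphism (Leray) -/

/-- **AN `q_*`-ACYCLIC K-INJECTIVE RESOLUTION OF `q^*•N•`**: for a bounded-below complex `N•` of vector bundles on `Y`, the pull-back `q^*•N•`
(bounded below, vector-bundle terms) has an injective resolution `ι : q^*•N• ⟶ I•` (Mathlib: enough injectives in `Mod 𝒪_{J×Ĵ}`), which is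
K-injective, and `q_*•ι` is a quasi-isomorphism — Leray's acyclicity for the affine `q` (`quasiIso_pushforward_map_of_injective_of_isFiniteLocallyFree`).
[cite: Hartshorne1977, III Prop. 8.1] [cite: StacksProject, Tag 01XC and Tag 0DVC] -/
theorem exists_kInjectiveResolution_quotientPullback (D : SecantQuotientDatum) (N : CochainComplex D.Y.X.left.Modules ℤ) (a : ℤ)
    (hNa : ∀ i, i < a → IsZero (N.X i)) (hN : ∀ i, IsFiniteLocallyFree (N.X i)) :
    ∃ (I : CochainComplex D.P.X.left.Modules ℤ) (ι : quotientPullbackComplex D N ⟶ I) (_ : I.IsKInjective),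
      letI := HasDerivedCategory.standard D.Y.X.left.Modules
      IsIso (Q.map (((Scheme.Modules.pushforward (Hom.toSchemeHom D.q)).mapHomologicalComplex (ComplexShape.up ℤ)).map ι)) := by
  letI := HasDerivedCategory.standard D.Y.X.left.Modules
  haveI : IsFinite (Hom.toSchemeHom D.q) := D.isIsogeny_q.2
  have hEa : ∀ i, i < a → IsZero ((quotientPullbackComplex D N).X i) := fun i hi =>
    (Scheme.Modules.pullback (Hom.toSchemeHom D.q)).map_isZero (hNa i hi)
  have hE : ∀ i, IsFiniteLocallyFree ((quotientPullbackComplex D N).X i) := fun i => (hN i).pullback (Hom.toSchemeHom D.q)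
  haveI : (quotientPullbackComplex D N).IsStrictlyGE a :=
    (CochainComplex.isStrictlyGE_iff (quotientPullbackComplex D N) a).mpr (fun i hi => hEa i hi)
  obtain ⟨I, ι, hι, hI, hIa⟩ :=
    CochainComplex.Plus.modelCategoryQuillen.exists_quasiIso_injective (quotientPullbackComplex D N) a
  have hR : QuasiIso (((Scheme.Modules.pushforward (Hom.toSchemeHom D.q)).mapHomologicalComplex (ComplexShape.up ℤ)).map ι) :=
    quasiIso_pushforward_map_of_injective_of_isFiniteLocallyFree (Hom.toSchemeHom D.q) ι a hEa
      (fun i hi => I.isZero_of_isStrictlyGE a i hi) hE hI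
  refine ⟨I, ι, CochainComplex.isKInjective_of_injective I a, ?_⟩
  rw [DerivedCategory.isIso_Q_map_iff_quasiIso]
  exact hR

/-! ## §3 (Dq-Inj) — `q^{**}` is injective -/

/-- The terms of a shift of a bounded complex of vector bundles are vector bundles. [folklore] -/
theorem isFiniteLocallyFree_shift_X {X : Scheme.{0}} {L : CochainComplex X.Modules ℤ} (hL : IsBoundedVBComplex L) (k i : ℤ) :
    IsFiniteLocallyFree ((L⟦k⟧).X i) :=
  Modules.isFiniteLocallyFree_of_iso (CochainComplex.shiftFunctorObjXIso L k i (i + k) rfl).symm (hL.isFiniteLocallyFree (i + k))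

/-- A shift of a bounded complex of vector bundles vanishes below some degree. [folklore] -/
theorem exists_isZero_shift_X_of_lt {X : Scheme.{0}} {L : CochainComplex X.Modules ℤ} (hL : IsBoundedVBComplex L) (k : ℤ) :
    ∃ a : ℤ, ∀ i, i < a → IsZero ((L⟦k⟧).X i) := by
  obtain ⟨a₀, b₀, hLa, -⟩ := IsBoundedVBComplex.exists_bounds hL
  exact ⟨a₀ - k, fun i hi => (hLa (i + k) (by omega)).of_iso (CochainComplex.shiftFunctorObjXIso L k i (i + k) rfl)⟩

/-- **(Dq-Inj) — `q^{**}` IS INJECTIVE ON `Hom_{D(Y)}(Q M•, (Q L•)⟦k⟧)` FOR `L•` A BOUNDED COMPLEX OF VECTOR BUNDLES** (every complex `M•`, every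
`k : ℤ`): the action `y ↦ Summit.Ventures.HSemireg.mapShiftedHom (Scheme.Modules.pullback q) y` of the exact `q^*` on shifted Homs — the body of the
support line's `pullbackExt D` (`Cruxes/DiagLocalOfMarkmanPinnedForall/SigmaDescent.lean`), whose (Dq-Inj) `PullbackExtInjective` is this with the
extra hypothesis `IsBoundedVBComplex M`. Proof: `Literature.Algebra.Homology.shiftedHom_map_mapDerivedCategory_injective` at the unit retraction (§1)
and the Leray resolution (§2) of `L•⟦k⟧`; `mapShiftedHom` differs from `y ↦ y.map D(q^*)` by the two factorisation isomorphisms. In print: «the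
arrows labeled `q^*` are all isomorphisms» (onto the `Ḡ^∨`-invariants; only injectivity is typed here).
[cite: Markman2025SecantWeil, §9.3 Lemma 9.3.9] [cite: Mukai1978, §3 Prop. 3.12 (p. 249)] [cite: StacksProject, Tag 0BVH and Tag 0DVC]
[cite: Lipman2009, Prop. 3.2.3] -/
theorem pullbackExt_injective (D : SecantQuotientDatum) (M L : CochainComplex D.Y.X.left.Modules ℤ) (hL : IsBoundedVBComplex L) (k : ℤ) :
    letI := HasDerivedCategory.standard D.Y.X.left.Modules
    letI := HasDerivedCategory.standard D.P.X.left.Modules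
    haveI := D.isIsogeny_q.preservesFiniteLimits_pullback
    Function.Injective fun y : ShiftedHom (Q.obj M) (Q.obj L) k =>
      Summit.Ventures.HSemireg.mapShiftedHom (Scheme.Modules.pullback (Hom.toSchemeHom D.q)) y := by
  letI := HasDerivedCategory.standard D.Y.X.left.Modules
  letI := HasDerivedCategory.standard D.P.X.left.Modules
  haveI := D.isIsogeny_q.preservesFiniteLimits_pullback
  intro x y hxy
  -- the two inputs of the faithfulness lemma, at `L⟦k⟧`
  obtain ⟨a, hLka⟩ := exists_isZero_shift_X_of_lt hL k
  obtain ⟨r, hr⟩ := exists_unitRetraction_quotientPullback D (L⟦k⟧) (isFiniteLocallyFree_shift_X hL k)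
  obtain ⟨I, ι, hI, hι⟩ := exists_kInjectiveResolution_quotientPullback D (L⟦k⟧) a hLka (isFiniteLocallyFree_shift_X hL k)
  apply shiftedHom_map_mapDerivedCategory_injective (Scheme.Modules.pullbackPushforwardAdjunction (Hom.toSchemeHom D.q)) M L k r hr ι hι
  -- `mapShiftedHom` is `y ↦ y.map D(q^*)` conjugated by the factorisation isomorphisms
  have h := hxy
  dsimp only at h
  unfold Summit.Ventures.HSemireg.mapShiftedHom at h
  rwa [cancel_epi, cancel_mono] at h

end NowhereDisplaceable

end Summit.HodgeConjecture.HodgeConjecture.Ring2.SemiregularRepresentatives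

end
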